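import Literature.NumberTheory.Rogawski1990.Ch3Sec13Prop3131Holds                  -- ★ `prop3131_holds` (PROP. 3.13.1, cocycle form) + the §3.13 vocabulary (`HTildePoints`, `detZero`, `gammaZero`)
import Summits.HodgeConjecture.HodgeConjecture.Theorems.R90S6UnramifiedNormParity    -- ★ K3 `isNormFromE_iff_even_log` (`x ∈ NE* ⟺ ord x` even, inert unramified letters)
import Literature.NumberTheory.Automorphic.U3LocalBruhatDecompositionProofs          -- ★ `UnitaryGroup.qsInvolution` (`Θ_σ g = w⁰ ᵗ(σg)⁻¹ w⁰`), `coe_qsInvolution`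
import HarnessLib

/-!
# R90 · S6 «Ch. 14.1–14.5 stable trace formula» — card K5: `κ̃` DETECTS `H` ON THE ε-CLASS — THE PROP. 3.13.1 BRIDGE
# (`Theorems/R90S6TwistedKappaHDetects.lean`)

Rows E1.4.4.2.4 («vanishing of `TO^{κ̃}` at `δ` whose norm class does not come from `H`») ∕ E1.4.4.3.1, dealer R90-C14-plan (g2), card K5
2026-09-05T01:31:37Z.  The organ is ★ `Ch3Sec10to13.prop3131_holds` — PROPOSITION 3.13.1 of [Rogawski1990] in cocycle form: for `γ ∈ H̃` elliptic
regular (`T = G_γ ⊂ H = U(2) × U(1)`, the centraliser of `γ₀ = d(1,−1,1)`) and a cocycle `α` (`αγ = γα`, `α ε(α) = 1`), **`det₀(α) ∈ NE*` iff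
`zα = h ε(h)⁻¹` for some `z ∈ F*`, `h ∈ H̃`** — the sign `κ̃(α) = ω_{E∕F}(det₀ α)` is `+1` exactly on the `H`-image of `𝒟_ε(δ∕F)`.  This file joins the
§3.13 letters (`ε = unitaryTwist σ Φ₃`, `Φ₃ = rogawskiPhi E 3 = antidiag(1,−1,1)`) to the S6 twisted currency (`Θ_σ = UnitaryGroup.qsInvolution σ`,
`J₀ = w⁰ = antidiag(1,1,1)`; ★ K3 `R90S6UnramifiedNormParity`, ★ K4 `R90S6TwistedKappaClassFunction`, ★ L4 `R90S6TwistedKappaOrbitalSign`):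
* §1 **THE JUNCTION `ε_{Φ₃} = Int(γ₀) ∘ Θ_σ`** — `Φ₃ = γ₀·w⁰ = w⁰·γ₀` (`γ₀ =` ★ `gammaZero`), so `ε_{Φ₃}(g) = γ₀ Θ_σ(g) γ₀` for EVERY `g`
  (`coe_unitaryTwist_eq_gammaZero_mul_mul_gammaZero`); the two twists are NOT equal on `GL₃(E)` (`U(Φ₃) ≠ U(w⁰)` as subgroups) but AGREE ON `H̃`
  (`unitaryTwist_eq_qsInvolution_of_mem_HTildePoints`), where PROP. 3.13.1's `γ`, `h` and (§3) `α` live.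
* §2 **`σ(det₀ α) = det₀ α` from the cocycle condition alone** (`map_detZero_eq_of_mul_unitaryTwist_eq_one`: `α = Φ₃ ᵗ(σα) Φ₃`, `det Φ₃ = 1`).
* §3 **Block-diagonality** (`mem_HTildePoints_of_commute`): a matrix commuting with a REGULAR `γ ∈ H̃` lies in `H̃` (char `≠ 2`; public form of the
  private step of ★ `Ch3Sec13Prop3131Holds`); hence `det₀ α ≠ 0` (`detZero_ne_zero_of_mem_HTildePoints`).
* §4 **HEAD `ite_isNormFromE_detZero_eq_one_iff`** — PROP. 3.13.1 as the SIGN statement, binders of ★ `prop3131` verbatim.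
* §5 **`negOnePow_log_detZero_eq_one_iff`** — the UNRAMIFIED VALUATION FORM in ★ K3's frame (`Valued K ℤᵐ⁰`; `σ` isometric, `ϖ` a `σ`-fixed
  uniformizer, fixed units are norms): `(ord det₀ α).negOnePow = 1 ⟺ (the same splitting)` (★ K3 `isNormFromE_iff_even_log` ∘ §4, §2–§3 supplying
  `det₀ α ∈ F^×`); `negOnePow_log_detZero_eq_one_iff_qsInvolution` — the same with `Θ_σ` on BOTH sides (`Θ_σ γ = γ`, `α Θ_σ(α) = 1`,
  `zα = h Θ_σ(h)⁻¹`), `Φ₃` built in place, `Standing` unbundled to `IsLocalOrGlobalField F`, `IsQuadraticConj F K σ` — the S6 consumer's letters.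

Lane `--kind proof --supports stmt-HodgeConjecture-24833 --as helper`; THEOREMS ONLY (no definition, no instance, no notation, no named fact, no `sorry`);
pure algebra, no measure ∕ `Φ_ε` side (ε-conjugation invariance is ★ `R90.S4.epsOrbitalIntegral_map_cosetCongr_conj`, by name).  Seat R90-C14-p08 (g0).
HONEST LABEL: a bridge lemma, count-neutral until E1.4.4.2.4 ∕ E1.4.4.3.1 consume it; HC_CM is proved only modulo the 7 printed citations (2 remaining named
inputs: hLiu418 = stmt-HodgeConjecture-24832, h413 = stmt-HodgeConjecture-24833) until rung 0 closes.

## References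
* [Rogawski1990] J. D. Rogawski, *Automorphic Representations of Unitary Groups in Three Variables*, Ann. of Math. Stud. 123 (1990): §3.13 Prop. 3.13.1
  p. 38; §3.7 p. 28 (`H = G_{d(1,−1,1)}`); §3.10 p. 33 (`ε`, `N`); §1.9 p. 8 (`Φ₃`); §4.10 p. 57 (`μ(det₀ δ)`).
* [Serre1979] J.-P. Serre, *Local Fields* (1979): Ch. V §2 Cor. (units of an unramified extension are norms) — through ★ K3.
-/

set_option autoImplicit false
-- the mandated namespace repeats the single-problem summit's segment (`HodgeConjecture.HodgeConjecture`)
set_option linter.dupNamespace false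

noncomputable section

open scoped Matrix MatrixGroups Valued WithZero
open Polynomial
open Literature.NumberTheory.Automorphic
open Literature.NumberTheory.Rogawski1990.Ch3Sec10to13
open Literature.NumberTheory.Rogawski1990.Ch4Sec10 (unitaryTwist fixedScalarSubgroup coe_unitaryTwist unitaryTwist_eq_self_iff_mem_unitaryGroup)
open Literature.AlgebraicGeometry.ShimuraVarieties (unitaryGroup)

namespace Summit.HodgeConjecture.HodgeConjecture.R90.S6

/-! ## §0 Matrix plumbing for `Φ₃`, `γ₀`, `w⁰` -/

section Plumbing

variable {E : Type} [Field E]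

/-- `Φ₃` explicitly. [cite: Rogawski1990, §1.9 p. 8] -/
private theorem rogawskiPhi_three_eq : rogawskiPhi E 3 = !![(0 : E), 0, 1; 0, -1, 0; 1, 0, 0] := by
  ext i j; fin_cases i <;> fin_cases j <;> simp [rogawskiPhi]

/-- `γ₀ = d(1,−1,1)` explicitly. [cite: Rogawski1990, §3.7 p. 28] -/
private theorem gammaZero_eq : gammaZero E = !![(1 : E), 0, 0; 0, -1, 0; 0, 0, 1] := by
  ext i j; fin_cases i <;> fin_cases j <;> simp [gammaZero]

/-- `w⁰ = antidiag(1,1,1)` explicitly. [folklore] -/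
private theorem coe_weylLong_three_eq :
    ((weylLong 3 E : GL (Fin 3) E) : Matrix (Fin 3) (Fin 3) E) = !![(0 : E), 0, 1; 0, 1, 0; 1, 0, 0] := by
  ext i j; rw [coe_weylLong, Equiv.Perm.permMatrix, PEquiv.toMatrix_toPEquiv_apply]
  fin_cases i <;> fin_cases j <;> simp [Fin.revPerm_apply]

/-- `Φ₃ = γ₀ · w⁰`. [folklore] -/
private theorem rogawskiPhi_eq_gammaZero_mul_weylLong :
    rogawskiPhi E 3 = gammaZero E * ((weylLong 3 E : GL (Fin 3) E) : Matrix (Fin 3) (Fin 3) E) := by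
  rw [rogawskiPhi_three_eq, gammaZero_eq, coe_weylLong_three_eq]; ext i j; fin_cases i <;> fin_cases j <;> simp

/-- `Φ₃ = w⁰ · γ₀`. [folklore] -/
private theorem rogawskiPhi_eq_weylLong_mul_gammaZero :
    rogawskiPhi E 3 = ((weylLong 3 E : GL (Fin 3) E) : Matrix (Fin 3) (Fin 3) E) * gammaZero E := by
  rw [rogawskiPhi_three_eq, gammaZero_eq, coe_weylLong_three_eq]; ext i j; fin_cases i <;> fin_cases j <;> simp

/-- `γ₀` commutes with `w⁰`. [folklore] -/
private theorem weylLong_commute_gammaZero : Commute ((weylLong 3 E : GL (Fin 3) E) : Matrix (Fin 3) (Fin 3) E) (gammaZero E) := by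
  show ((weylLong 3 E : GL (Fin 3) E) : Matrix (Fin 3) (Fin 3) E) * gammaZero E = gammaZero E * ((weylLong 3 E : GL (Fin 3) E) : Matrix (Fin 3) (Fin 3) E)
  rw [← rogawskiPhi_eq_gammaZero_mul_weylLong, ← rogawskiPhi_eq_weylLong_mul_gammaZero]

/-- `γ₀² = 1`. [folklore] -/
private theorem gammaZero_mul_gammaZero : gammaZero E * gammaZero E = 1 := by
  rw [gammaZero_eq]; ext i j; fin_cases i <;> fin_cases j <;> simp

/-- `σ(γ₀) = γ₀` entrywise. [folklore] -/
private theorem gammaZero_map (τ : E →+* E) : (gammaZero E).map τ = gammaZero E := by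
  rw [gammaZero_eq]; ext i j; fin_cases i <;> fin_cases j <;> simp

/-- `det Φ₃ = 1`. [folklore] -/
private theorem det_rogawskiPhi_three : (rogawskiPhi E 3).det = 1 := by
  rw [rogawskiPhi_three_eq]; simp [Matrix.det_fin_three]

/-- `Φ₃² = 1`. [folklore] -/
private theorem rogawskiPhi_three_mul_self : rogawskiPhi E 3 * rogawskiPhi E 3 = 1 := by
  rw [rogawskiPhi_three_eq]; ext i j; fin_cases i <;> fin_cases j <;> simp

/-- `ᵗ(τΦ₃) = Φ₃` (`Φ₃` is hermitian: entries `0, ±1`). [cite: Rogawski1990, §1.9 p. 8] -/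
private theorem rogawskiPhi_three_map_transpose (τ : E →+* E) : ((rogawskiPhi E 3).map τ)ᵀ = rogawskiPhi E 3 := by
  rw [rogawskiPhi_three_eq]; ext i j; fin_cases i <;> fin_cases j <;> simp

/-- `Φ₃ X Φ₃` entrywise. [folklore] -/
private theorem phiThree_sandwich (X : Matrix (Fin 3) (Fin 3) E) :
    !![(0 : E), 0, 1; 0, -1, 0; 1, 0, 0] * X * !![(0 : E), 0, 1; 0, -1, 0; 1, 0, 0] =
      !![X 2 2, -X 2 1, X 2 0; -X 1 2, X 1 1, -X 1 0; X 0 2, -X 0 1, X 0 0] := by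
  ext i j; rw [Matrix.mul_apply]; simp only [Matrix.mul_apply, Fin.sum_univ_three]
  fin_cases i <;> fin_cases j <;> simp

/-- With `↑Φ = Φ₃`: `Φ⁻¹ = Φ` in `GL₃(E)`. [folklore] -/
private theorem phi_inv_eq {Φ : GL (Fin 3) E} (hΦ : ((Φ : GL (Fin 3) E) : Matrix (Fin 3) (Fin 3) E) = rogawskiPhi E 3) : Φ⁻¹ = Φ := by
  refine inv_eq_of_mul_eq_one_right (Units.ext ?_)
  rw [Units.val_mul, hΦ, Units.val_one]
  exact rogawskiPhi_three_mul_self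

/-- The matrix of `σ g` is `σ` applied entrywise. [folklore] -/
private theorem coe_map_eq (τ : E →+* E) (g : GL (Fin 3) E) :
    ((Matrix.GeneralLinearGroup.map τ g : GL (Fin 3) E) : Matrix (Fin 3) (Fin 3) E) = ((g : GL (Fin 3) E) : Matrix (Fin 3) (Fin 3) E).map τ :=
  rfl

/-- The determinant of a block-diagonal `3 × 3` matrix (blocks `{0,2}`, `{1}`). [folklore] -/
private theorem det_block {M : Matrix (Fin 3) (Fin 3) E} (h01 : M 0 1 = 0) (h10 : M 1 0 = 0) (h12 : M 1 2 = 0) (h21 : M 2 1 = 0) :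
    M.det = M 1 1 * (M 0 0 * M 2 2 - M 0 2 * M 2 0) := by
  rw [Matrix.det_fin_three, h01, h10, h12, h21]
  ring

/-- A matrix commuting with `γ₀ = d(1,−1,1)` is block-diagonal on `{0,2} ⊔ {1}` (char `≠ 2`). [folklore] -/
private theorem offblock_eq_zero (h2 : (2 : E) ≠ 0) {M : Matrix (Fin 3) (Fin 3) E}
    (h : M * gammaZero E = gammaZero E * M) : M 0 1 = 0 ∧ M 1 0 = 0 ∧ M 1 2 = 0 ∧ M 2 1 = 0 := by
  have h01 := congrFun (congrFun h 0) 1; have h10 := congrFun (congrFun h 1) 0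
  have h12 := congrFun (congrFun h 1) 2; have h21 := congrFun (congrFun h 2) 1
  simp [gammaZero, Matrix.mul_apply, Matrix.diagonal] at h01 h10 h12 h21
  refine ⟨(mul_eq_zero.1 (?_ : (2 : E) * M 0 1 = 0)).resolve_left h2, (mul_eq_zero.1 (?_ : (2 : E) * M 1 0 = 0)).resolve_left h2,
    (mul_eq_zero.1 (?_ : (2 : E) * M 1 2 = 0)).resolve_left h2, (mul_eq_zero.1 (?_ : (2 : E) * M 2 1 = 0)).resolve_left h2⟩
  · linear_combination -h01
  · linear_combination h10
  · linear_combination h12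
  · linear_combination -h21

/-- Conversely, a block-diagonal matrix commutes with `γ₀`. [folklore] -/
private theorem mul_gammaZero_eq_of_offblock {M : Matrix (Fin 3) (Fin 3) E} (h01 : M 0 1 = 0) (h10 : M 1 0 = 0) (h12 : M 1 2 = 0)
    (h21 : M 2 1 = 0) : M * gammaZero E = gammaZero E * M := by
  rw [gammaZero_eq]; ext i j; fin_cases i <;> fin_cases j <;> simp [Matrix.mul_apply, Fin.sum_univ_three, h01, h10, h12, h21]

/-- The characteristic polynomial of a block-diagonal `3 × 3` matrix (blocks `{0,2}` and `{1}`). [folklore] -/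
private theorem charpoly_block {γ : Matrix (Fin 3) (Fin 3) E} (h01 : γ 0 1 = 0) (h10 : γ 1 0 = 0) (h12 : γ 1 2 = 0)
    (h21 : γ 2 1 = 0) :
    γ.charpoly = (X - C (γ 1 1)) * ((X - C (γ 0 0)) * (X - C (γ 2 2)) - C (γ 0 2 * γ 2 0)) := by
  unfold Matrix.charpoly
  rw [Matrix.det_fin_three]
  have e : ∀ i j : Fin 3, i ≠ j → γ i j = 0 → γ.charmatrix i j = 0 := fun i j hij h => by
    rw [Matrix.charmatrix_apply_ne _ _ _ hij, h, map_zero, neg_zero]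
  have e01 := e 0 1 (by decide) h01; have e10 := e 1 0 (by decide) h10
  have e12 := e 1 2 (by decide) h12; have e21 := e 2 1 (by decide) h21
  rw [e01, e10, e12, e21, Matrix.charmatrix_apply_eq, Matrix.charmatrix_apply_eq, Matrix.charmatrix_apply_eq,
    Matrix.charmatrix_apply_ne _ _ _ (by decide), Matrix.charmatrix_apply_ne _ _ _ (by decide), map_mul]
  ring

/-- If `X − b` is coprime to `q` then `q(b) ≠ 0`. [folklore] -/
private theorem eval_ne_zero_of_isCoprime {b : E} {q : E[X]} (h : IsCoprime (X - C b) q) : q.eval b ≠ 0 := by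
  obtain ⟨u, v, huv⟩ := h
  intro hq
  have := congrArg (Polynomial.eval b) huv
  simp [Polynomial.eval_add, Polynomial.eval_mul, hq] at this

/-- A matrix commuting with a REGULAR block-diagonal matrix (blocks `{0,2}`, `{1}`) is block-diagonal. [folklore] -/
private theorem offblock_eq_zero_of_commute_regular {γ α : Matrix (Fin 3) (Fin 3) E} (h01 : γ 0 1 = 0) (h10 : γ 1 0 = 0)
    (h12 : γ 1 2 = 0) (h21 : γ 2 1 = 0) (hsep : γ.charpoly.Separable) (hc : α * γ = γ * α) :
    α 0 1 = 0 ∧ α 1 0 = 0 ∧ α 1 2 = 0 ∧ α 2 1 = 0 := by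
  rw [charpoly_block h01 h10 h12 h21] at hsep
  have hD := eval_ne_zero_of_isCoprime hsep.isCoprime
  simp only [eval_sub, eval_mul, eval_X, eval_C] at hD
  have c01 := congrFun (congrFun hc 0) 1; have c21 := congrFun (congrFun hc 2) 1
  have c10 := congrFun (congrFun hc 1) 0; have c12 := congrFun (congrFun hc 1) 2
  simp only [Matrix.mul_apply, Fin.sum_univ_three, h01, h10, h12, h21, mul_zero, zero_mul, add_zero, zero_add] at c01 c21 c10 c12
  refine ⟨?_, ?_, ?_, ?_⟩
  · refine (mul_eq_zero.1 (?_ : ((γ 1 1 - γ 0 0) * (γ 1 1 - γ 2 2) - γ 0 2 * γ 2 0) * α 0 1 = 0)).resolve_left hD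
    linear_combination (γ 1 1 - γ 2 2) * c01 + γ 0 2 * c21
  · refine (mul_eq_zero.1 (?_ : ((γ 1 1 - γ 0 0) * (γ 1 1 - γ 2 2) - γ 0 2 * γ 2 0) * α 1 0 = 0)).resolve_left hD
    linear_combination -((γ 1 1 - γ 2 2) * c10) - γ 2 0 * c12
  · refine (mul_eq_zero.1 (?_ : ((γ 1 1 - γ 0 0) * (γ 1 1 - γ 2 2) - γ 0 2 * γ 2 0) * α 1 2 = 0)).resolve_left hD
    linear_combination -((γ 1 1 - γ 0 0) * c12) - γ 0 2 * c10
  · refine (mul_eq_zero.1 (?_ : ((γ 1 1 - γ 0 0) * (γ 1 1 - γ 2 2) - γ 0 2 * γ 2 0) * α 2 1 = 0)).resolve_left hD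
    linear_combination (γ 1 1 - γ 0 0) * c21 + γ 2 0 * c01

/-- If `g ∈ H̃` then `Θ_τ(g)` commutes with `γ₀` (as matrices): `τγ₀ = γ₀ = ᵗγ₀` and `γ₀ w⁰ = w⁰ γ₀`. [cite: Rogawski1990, §3.7 p. 28] -/
private theorem coe_qsInvolution_commute_gammaZero (τ : E →+* E) {g : GL (Fin 3) E} (hg : g ∈ HTildePoints E) :
    Commute ((UnitaryGroup.qsInvolution τ g : GL (Fin 3) E) : Matrix (Fin 3) (Fin 3) E) (gammaZero E) := by
  have hg' : ((g : GL (Fin 3) E) : Matrix (Fin 3) (Fin 3) E) * gammaZero E = gammaZero E * ((g : GL (Fin 3) E) : Matrix (Fin 3) (Fin 3) E) := hg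
  have hτg : ((g : GL (Fin 3) E) : Matrix (Fin 3) (Fin 3) E).map τ * gammaZero E =
      gammaZero E * ((g : GL (Fin 3) E) : Matrix (Fin 3) (Fin 3) E).map τ := by
    have := congrArg (fun M : Matrix (Fin 3) (Fin 3) E => M.map τ) hg'
    simpa only [Matrix.map_mul, gammaZero_map] using this
  have hunit : IsUnit (((g : GL (Fin 3) E) : Matrix (Fin 3) (Fin 3) E).map τ).det := by
    rw [← RingHom.mapMatrix_apply, ← RingHom.map_det]
    exact (Matrix.isUnits_det_units g).map τ
  have hinv : (((g : GL (Fin 3) E) : Matrix (Fin 3) (Fin 3) E).map τ)⁻¹ * gammaZero E =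
      gammaZero E * (((g : GL (Fin 3) E) : Matrix (Fin 3) (Fin 3) E).map τ)⁻¹ :=
    calc (((g : GL (Fin 3) E) : Matrix (Fin 3) (Fin 3) E).map τ)⁻¹ * gammaZero E
        = (((g : GL (Fin 3) E) : Matrix (Fin 3) (Fin 3) E).map τ)⁻¹ * gammaZero E * (((g : GL (Fin 3) E) : Matrix (Fin 3) (Fin 3) E).map τ) * (((g : GL (Fin 3) E) : Matrix (Fin 3) (Fin 3) E).map τ)⁻¹ :=
          (Matrix.mul_nonsing_inv_cancel_right _ _ hunit).symm
      _ = gammaZero E * (((g : GL (Fin 3) E) : Matrix (Fin 3) (Fin 3) E).map τ)⁻¹ := by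
          rw [Matrix.mul_assoc _ (gammaZero E), ← hτg, Matrix.nonsing_inv_mul_cancel_left _ _ hunit]
  have hT : gammaZero E = (gammaZero E)ᵀ := by rw [gammaZero, Matrix.diagonal_transpose]
  have hinvT : Commute ((((g : GL (Fin 3) E) : Matrix (Fin 3) (Fin 3) E).map τ)⁻¹)ᵀ (gammaZero E) := by
    change _ * _ = _ * _; rw [hT, ← Matrix.transpose_mul, ← Matrix.transpose_mul, hinv]
  rw [UnitaryGroup.coe_qsInvolution]
  exact (weylLong_commute_gammaZero.mul_left hinvT).mul_left weylLong_commute_gammaZero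

end Plumbing

/-! ## §1 The junction `ε_{Φ₃} = Int(γ₀) ∘ Θ_σ`; equality on `H̃` -/

section Junction

variable {E : Type} [Field E] [TopologicalSpace E] (σ : E →+* E) {Φ : GL (Fin 3) E}

/-- **K5 §1 — `ε_{Φ₃}(g) = γ₀ · Θ_σ(g) · γ₀` FOR EVERY `g ∈ GL₃(E)`**: Rogawski's unitary twist for `Φ₃ = antidiag(1,−1,1)` (★ `Ch4Sec10.unitaryTwist`,
`ε(g) = Φ₃⁻¹ ᵗ(σg)⁻¹ Φ₃`) and the S6 quasi-split involution `Θ_σ(g) = w⁰ ᵗ(σg)⁻¹ w⁰` (★ `UnitaryGroup.qsInvolution`, `w⁰ = antidiag(1,1,1)`) differ by the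
inner automorphism of `γ₀ = d(1,−1,1)` (★ `gammaZero`), because `Φ₃ = γ₀ w⁰ = w⁰ γ₀` and `Φ₃⁻¹ = Φ₃`. [cite: Rogawski1990, §3.10 p. 33; §1.9 p. 8; §3.7 p. 28] -/
theorem coe_unitaryTwist_eq_gammaZero_mul_mul_gammaZero (hΦ : ((Φ : GL (Fin 3) E) : Matrix (Fin 3) (Fin 3) E) = rogawskiPhi E 3)
    (g : GL (Fin 3) E) :
    ((unitaryTwist σ Φ g : GL (Fin 3) E) : Matrix (Fin 3) (Fin 3) E) =
      gammaZero E * ((UnitaryGroup.qsInvolution σ g : GL (Fin 3) E) : Matrix (Fin 3) (Fin 3) E) * gammaZero E := by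
  rw [coe_unitaryTwist, UnitaryGroup.coe_qsInvolution, phi_inv_eq hΦ, hΦ, Matrix.coe_units_inv, coe_map_eq]
  conv_lhs => enter [2]; rw [rogawskiPhi_eq_weylLong_mul_gammaZero]
  rw [rogawskiPhi_eq_gammaZero_mul_weylLong]
  simp only [Matrix.mul_assoc]

/-- **K5 §1 — ON `H̃` THE TWO TWISTS AGREE: `ε_{Φ₃}(g) = Θ_σ(g)` for `g ∈ H̃`** (`H̃ = H(E)`, ★ `HTildePoints`, the centraliser of `γ₀ = d(1,−1,1)`):
`Θ_σ(g)` commutes with `γ₀` when `g` does (`σγ₀ = γ₀ = ᵗγ₀`, `γ₀ w⁰ = w⁰ γ₀`), and `γ₀² = 1`.  PROP. 3.13.1's `γ`, `h` and the cocycle `α` all lie in `H̃`.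
[cite: Rogawski1990, §3.7 p. 28; §3.10 p. 33; §3.13 p. 38] -/
theorem unitaryTwist_eq_qsInvolution_of_mem_HTildePoints (hΦ : ((Φ : GL (Fin 3) E) : Matrix (Fin 3) (Fin 3) E) = rogawskiPhi E 3)
    {g : GL (Fin 3) E} (hg : g ∈ HTildePoints E) : unitaryTwist σ Φ g = UnitaryGroup.qsInvolution σ g := by
  refine Units.ext ?_
  rw [coe_unitaryTwist_eq_gammaZero_mul_mul_gammaZero σ hΦ, Matrix.mul_assoc, (coe_qsInvolution_commute_gammaZero σ hg).eq, ← Matrix.mul_assoc,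
    gammaZero_mul_gammaZero, Matrix.one_mul]

/-! ## §2 `σ(det₀ α) = det₀ α` from the cocycle condition -/

/-- The cocycle condition `α ε(α) = 1` as a matrix identity: `α = Φ₃ ᵗ(σα) Φ₃`. [cite: Rogawski1990, §3.11 p. 35; §3.13 p. 38] -/
private theorem coe_eq_of_mul_unitaryTwist_eq_one (hΦ : ((Φ : GL (Fin 3) E) : Matrix (Fin 3) (Fin 3) E) = rogawskiPhi E 3) {α : GL (Fin 3) E}
    (hcoc : α * unitaryTwist σ Φ α = 1) :
    ((α : GL (Fin 3) E) : Matrix (Fin 3) (Fin 3) E) = rogawskiPhi E 3 * (((α : GL (Fin 3) E) : Matrix (Fin 3) (Fin 3) E).map σ)ᵀ * rogawskiPhi E 3 := by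
  have h : α = unitaryTwist σ Φ α⁻¹ := by rw [map_inv]; exact eq_inv_of_mul_eq_one_left hcoc
  have := congrArg (fun u : GL (Fin 3) E => (u : Matrix (Fin 3) (Fin 3) E)) h
  rw [coe_unitaryTwist, map_inv, inv_inv, phi_inv_eq hΦ, hΦ, coe_map_eq] at this
  exact this

/-- **K5 §2 — THE COCYCLE CONDITION ALONE PUTS `det α`, `α₁₁` AND `det₀ α` IN `F`**: if `α ε(α) = 1` (`ε = ε_{Φ₃}`) then `σ(det α) = det α`, `σ(α₁₁) = α₁₁`,
hence `σ(det₀ α) = det₀ α` (★ `detZero`: `det₀ α = det α · α₁₁⁻¹`) — no commuting `γ` is needed for this step. [cite: Rogawski1990, §3.13 Prop. 3.13.1 p. 38] -/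
theorem map_detZero_eq_of_mul_unitaryTwist_eq_one (hΦ : ((Φ : GL (Fin 3) E) : Matrix (Fin 3) (Fin 3) E) = rogawskiPhi E 3) {α : GL (Fin 3) E}
    (hcoc : α * unitaryTwist σ Φ α = 1) :
    σ (((α : GL (Fin 3) E) : Matrix (Fin 3) (Fin 3) E).det) = ((α : GL (Fin 3) E) : Matrix (Fin 3) (Fin 3) E).det ∧
      σ (((α : GL (Fin 3) E) : Matrix (Fin 3) (Fin 3) E) 1 1) = ((α : GL (Fin 3) E) : Matrix (Fin 3) (Fin 3) E) 1 1 ∧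
        σ (detZero E α) = detZero E α := by
  have hA := coe_eq_of_mul_unitaryTwist_eq_one σ hΦ hcoc
  have hdet : σ (((α : GL (Fin 3) E) : Matrix (Fin 3) (Fin 3) E).det) = ((α : GL (Fin 3) E) : Matrix (Fin 3) (Fin 3) E).det := by
    conv_rhs => rw [hA]
    rw [Matrix.det_mul, Matrix.det_mul, det_rogawskiPhi_three, Matrix.det_transpose, ← RingHom.mapMatrix_apply, ← RingHom.map_det, mul_one, one_mul]
  have h11 : σ (((α : GL (Fin 3) E) : Matrix (Fin 3) (Fin 3) E) 1 1) = ((α : GL (Fin 3) E) : Matrix (Fin 3) (Fin 3) E) 1 1 := by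
    have hA' := hA
    rw [rogawskiPhi_three_eq, phiThree_sandwich] at hA'
    have e := congrFun (congrFun hA' 1) 1
    simpa using e.symm
  refine ⟨hdet, h11, ?_⟩
  unfold detZero
  have hval : ((Matrix.GeneralLinearGroup.det α : Eˣ) : E) = ((α : GL (Fin 3) E) : Matrix (Fin 3) (Fin 3) E).det := rfl
  rw [hval, map_mul, map_inv₀, hdet, h11]

end Junction

/-! ## §3 Block-diagonality: a matrix commuting with a regular `γ ∈ H̃` lies in `H̃`; `det₀ ≠ 0` on `H̃` -/

section Block

variable {E : Type} [Field E]

/-- **K5 §3 — `α ∈ H̃` WHEN `α` COMMUTES WITH A REGULAR `γ ∈ H̃`** (char `E ≠ 2`): `γ ∈ H̃` is block-diagonal on `{e₀, e₂} ⊕ {e₁}`, `charpoly γ = (X − γ₁₁)·q`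
separable forces `q(γ₁₁) ≠ 0`, and the off-block entries of `α` solve a `2 × 2` system of determinant `q(γ₁₁)`.  (PROP. 3.13.1's cocycles `t_ν = α ∈ T̃ = T(E)`,
`T = G_γ ⊂ H`, therefore lie in `H̃`; public form of the private step of ★ `Ch3Sec13Prop3131Holds`.) [cite: Rogawski1990, §3.13 p. 38; §3.7 p. 28] -/
theorem mem_HTildePoints_of_commute (h2 : (2 : E) ≠ 0) {γ α : GL (Fin 3) E} (hγH : γ ∈ HTildePoints E)
    (hreg : Literature.NumberTheory.Rogawski1990.Ch3Sec10to13.IsRegular E γ) (hcomm : Commute α γ) : α ∈ HTildePoints E := by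
  obtain ⟨g01, g10, g12, g21⟩ := offblock_eq_zero h2 hγH
  have hc : ((α : GL (Fin 3) E) : Matrix (Fin 3) (Fin 3) E) * ((γ : GL (Fin 3) E) : Matrix (Fin 3) (Fin 3) E) =
      ((γ : GL (Fin 3) E) : Matrix (Fin 3) (Fin 3) E) * ((α : GL (Fin 3) E) : Matrix (Fin 3) (Fin 3) E) := by
    have := congrArg (fun u : GL (Fin 3) E => (u : Matrix (Fin 3) (Fin 3) E)) hcomm.eq
    simpa only [Units.val_mul] using this
  obtain ⟨a01, a10, a12, a21⟩ := offblock_eq_zero_of_commute_regular g01 g10 g12 g21 hreg hc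
  exact mul_gammaZero_eq_of_offblock a01 a10 a12 a21

/-- **K5 §3 — `det₀ α ≠ 0` for `α ∈ H̃`** (`det α = α₁₁ · (α₀₀α₂₂ − α₀₂α₂₀) ≠ 0` forces `α₁₁ ≠ 0`; char `E ≠ 2`). [cite: Rogawski1990, §3.13 p. 38] -/
theorem detZero_ne_zero_of_mem_HTildePoints (h2 : (2 : E) ≠ 0) {α : GL (Fin 3) E} (hα : α ∈ HTildePoints E) : detZero E α ≠ 0 := by
  obtain ⟨a01, a10, a12, a21⟩ := offblock_eq_zero h2 hα
  have hdet : ((α : GL (Fin 3) E) : Matrix (Fin 3) (Fin 3) E).det ≠ 0 := Matrix.GeneralLinearGroup.det_ne_zero α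
  have h11 : ((α : GL (Fin 3) E) : Matrix (Fin 3) (Fin 3) E) 1 1 ≠ 0 := fun h0 => by
    rw [det_block a01 a10 a12 a21, h0, zero_mul] at hdet; exact hdet rfl
  unfold detZero
  have hval : ((Matrix.GeneralLinearGroup.det α : Eˣ) : E) = ((α : GL (Fin 3) E) : Matrix (Fin 3) (Fin 3) E).det := rfl
  rw [hval]
  exact mul_ne_zero hdet (inv_ne_zero h11)

end Block

/-! ## §4 HEAD: PROP. 3.13.1 as the sign statement `κ̃(α) = 1 ⟺ α splits in H̃ modulo F*` -/

section Head

variable {F E : Type} [Field F] [Field E] [Algebra F E] [TopologicalSpace E] (σ : E ≃ₐ[F] E) (Φ : GL (Fin 3) E)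

open Classical in
/-- **K5 HEAD — `κ̃` DETECTS `H`: `([det₀ α ∈ NE*] ? 1 : −1) = 1 ⟺ zα = h ε(h)⁻¹` for some `z ∈ F*`, `h ∈ H̃`** — PROPOSITION 3.13.1 («`det₀(t_ν) ∈ NE*` if
and only if `ν` belongs to the image of `𝒟_H(T∕F)`») in the SIGN letters of ★ K3 ∕ ★ L4 (`κ̃ ∈ ℤˣ` as a classical `if`), with the binders of ★ `prop3131`
verbatim: `Φ = Φ₃`, `γ ∈ G(F) ∩ H̃` elliptic regular, `αγ = γα`, `α ε(α) = 1`.  So the `κ̃`-weighted sum over `𝒟_ε(δ∕F)` sees exactly the classes coming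
from `H`. [cite: Rogawski1990, §3.13 Prop. 3.13.1 p. 38; §4.10 p. 57] -/
theorem ite_isNormFromE_detZero_eq_one_iff (hSt : Standing F E σ Φ) (hΦ : ((Φ : GL (Fin 3) E) : Matrix (Fin 3) (Fin 3) E) = rogawskiPhi E 3)
    (γ : ↥(unitaryGroup (σ : E →+* E) ((Φ : GL (Fin 3) E) : Matrix (Fin 3) (Fin 3) E))) (hγH : (γ : GL (Fin 3) E) ∈ HTildePoints E)
    (hell : IsEllipticRegular F E σ (γ : GL (Fin 3) E)) (α : GL (Fin 3) E) (hcomm : Commute α (γ : GL (Fin 3) E))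
    (hcoc : α * unitaryTwist (σ : E →+* E) Φ α = 1) :
    (if IsNormFromE F E σ (detZero E α) then (1 : ℤˣ) else -1) = 1 ↔
      ∃ z h : GL (Fin 3) E, z ∈ fixedScalarSubgroup (σ : E →+* E) ∧ h ∈ HTildePoints E ∧ z * α = h * (unitaryTwist (σ : E →+* E) Φ h)⁻¹ := by
  rw [← prop3131_holds F E σ Φ hSt hΦ γ hγH hell α hcomm hcoc]
  by_cases h : IsNormFromE F E σ (detZero E α)
  · rw [if_pos h]; exact ⟨fun _ => h, fun _ => rfl⟩
  · rw [if_neg h]; exact ⟨fun h1 => absurd h1 (by decide), fun hN => absurd hN h⟩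

end Head

/-! ## §5 The unramified valuation form (K3's frame), in `ε`-letters and in `Θ_σ`-letters -/

section Valued

variable {F K : Type} [Field F] [Field K] [Algebra F K] [Valued K ℤᵐ⁰] (σ : K ≃ₐ[F] K)

omit [Valued K ℤᵐ⁰] in
/-- Characteristic `≠ 2` in `K` from `Standing`'s `char F = 0`. [folklore] -/
private theorem two_ne_zero_of_isLocalOrGlobalField (hF : IsLocalOrGlobalField F) : (2 : K) ≠ 0 := by
  haveI : CharZero F := hF.1; haveI : CharZero K := charZero_of_injective_algebraMap (algebraMap F K).injective
  exact two_ne_zero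

/-- **K5 §5 — THE UNRAMIFIED VALUATION FORM: `(ord_w det₀ α).negOnePow = 1 ⟺ zα = h ε(h)⁻¹` for some `z ∈ F*`, `h ∈ H̃`** — ★ K3
`isNormFromE_iff_even_log` (at an inert unramified place: `σ` isometric, `ϖ` a `σ`-fixed uniformizer, `σ`-fixed units are norms — binders `hvσ`, `hϖ`,
`hσϖ`, `hunit` as in ★ `Theorems/R90S6UnramifiedNormParity`) composed with §4; §2 supplies `σ(det₀ α) = det₀ α` and §3 `det₀ α ≠ 0`.  This is the letter
in which E1.4.4.2.4 reads «`κ̃` = the parity of the vertex type». [cite: Rogawski1990, §3.13 Prop. 3.13.1 p. 38; §4.10 p. 57] [cite: Serre1979, Ch. V §2 Cor.] -/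
theorem negOnePow_log_detZero_eq_one_iff (hvσ : ∀ a, Valued.v (σ a) = Valued.v a) {ϖ : K} (hϖ : Valued.v ϖ = WithZero.exp (-1 : ℤ))
    (hσϖ : σ ϖ = ϖ) (hunit : ∀ u : K, Valued.v u = 1 → σ u = u → ∃ s : K, s * σ s = u) {Φ : GL (Fin 3) K} (hSt : Standing F K σ Φ)
    (hΦ : ((Φ : GL (Fin 3) K) : Matrix (Fin 3) (Fin 3) K) = rogawskiPhi K 3)
    (γ : ↥(unitaryGroup (σ : K →+* K) ((Φ : GL (Fin 3) K) : Matrix (Fin 3) (Fin 3) K))) (hγH : (γ : GL (Fin 3) K) ∈ HTildePoints K)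
    (hell : IsEllipticRegular F K σ (γ : GL (Fin 3) K)) (α : GL (Fin 3) K) (hcomm : Commute α (γ : GL (Fin 3) K))
    (hcoc : α * unitaryTwist (σ : K →+* K) Φ α = 1) :
    (WithZero.log (Valued.v (detZero K α))).negOnePow = 1 ↔
      ∃ z h : GL (Fin 3) K, z ∈ fixedScalarSubgroup (σ : K →+* K) ∧ h ∈ HTildePoints K ∧ z * α = h * (unitaryTwist (σ : K →+* K) Φ h)⁻¹ := by
  have h2 : (2 : K) ≠ 0 := two_ne_zero_of_isLocalOrGlobalField hSt.1
  have hx : detZero K α ≠ 0 := detZero_ne_zero_of_mem_HTildePoints h2 (mem_HTildePoints_of_commute h2 hγH hell.1 hcomm)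
  have hσx : σ (detZero K α) = detZero K α := (map_detZero_eq_of_mul_unitaryTwist_eq_one (σ : K →+* K) hΦ hcoc).2.2
  rw [Int.negOnePow_eq_one_iff, ← isNormFromE_iff_even_log σ hvσ hϖ hσϖ hunit hx hσx]
  exact prop3131_holds F K σ Φ hSt hΦ γ hγH hell α hcomm hcoc

/-- **K5 §5 — THE SAME IN THE S6 LETTERS (`Θ_σ` ON BOTH SIDES)**: for `γ ∈ H̃` with `Θ_σ γ = γ` (so `γ ∈ U(Φ₃)(F)`, §1) elliptic regular, and `α` with
`αγ = γα`, `α Θ_σ(α) = 1`: `(ord_w det₀ α).negOnePow = 1 ⟺ zα = h Θ_σ(h)⁻¹` for some `z ∈ F*`, `h ∈ H̃` — `Φ₃` is built in place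
(`GeneralLinearGroup.mkOfDetNeZero (rogawskiPhi K 3)`), `Standing` unbundled to `IsLocalOrGlobalField F`, `IsQuadraticConj F K σ` (`Φ₃` is hermitian), and
every `ε_{Φ₃}` converted to `Θ_σ` on `H̃` by §1 (`α ∈ H̃` by §3). [cite: Rogawski1990, §3.13 Prop. 3.13.1 p. 38; §3.7 p. 28] [cite: Serre1979, Ch. V §2 Cor.] -/
theorem negOnePow_log_detZero_eq_one_iff_qsInvolution (hvσ : ∀ a, Valued.v (σ a) = Valued.v a) {ϖ : K}
    (hϖ : Valued.v ϖ = WithZero.exp (-1 : ℤ)) (hσϖ : σ ϖ = ϖ) (hunit : ∀ u : K, Valued.v u = 1 → σ u = u → ∃ s : K, s * σ s = u)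
    (hF : IsLocalOrGlobalField F) (hσq : IsQuadraticConj F K σ) {γ α : GL (Fin 3) K} (hγH : γ ∈ HTildePoints K)
    (hγΘ : UnitaryGroup.qsInvolution (σ : K →+* K) γ = γ) (hell : IsEllipticRegular F K σ γ) (hcomm : Commute α γ)
    (hcoc : α * UnitaryGroup.qsInvolution (σ : K →+* K) α = 1) :
    (WithZero.log (Valued.v (detZero K α))).negOnePow = 1 ↔
      ∃ z h : GL (Fin 3) K, z ∈ fixedScalarSubgroup (σ : K →+* K) ∧ h ∈ HTildePoints K ∧
        z * α = h * (UnitaryGroup.qsInvolution (σ : K →+* K) h)⁻¹ := by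
  have h2 : (2 : K) ≠ 0 := two_ne_zero_of_isLocalOrGlobalField hF
  have hdet : (rogawskiPhi K 3).det ≠ 0 := by rw [det_rogawskiPhi_three]; exact one_ne_zero
  have hΦ : ((Matrix.GeneralLinearGroup.mkOfDetNeZero (rogawskiPhi K 3) hdet : GL (Fin 3) K) : Matrix (Fin 3) (Fin 3) K) = rogawskiPhi K 3 := rfl
  have hSt : Standing F K σ (Matrix.GeneralLinearGroup.mkOfDetNeZero (rogawskiPhi K 3) hdet) :=
    ⟨hF, hσq, by rw [hΦ]; exact rogawskiPhi_three_map_transpose (σ : K →+* K)⟩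
  have hαH : α ∈ HTildePoints K := mem_HTildePoints_of_commute h2 hγH hell.1 hcomm
  have hγU : γ ∈ unitaryGroup (σ : K →+* K)
      ((Matrix.GeneralLinearGroup.mkOfDetNeZero (rogawskiPhi K 3) hdet : GL (Fin 3) K) : Matrix (Fin 3) (Fin 3) K) := by
    rw [← unitaryTwist_eq_self_iff_mem_unitaryGroup, unitaryTwist_eq_qsInvolution_of_mem_HTildePoints (σ : K →+* K) hΦ hγH]; exact hγΘ
  have hcoc' : α * unitaryTwist (σ : K →+* K) (Matrix.GeneralLinearGroup.mkOfDetNeZero (rogawskiPhi K 3) hdet) α = 1 := by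
    rw [unitaryTwist_eq_qsInvolution_of_mem_HTildePoints (σ : K →+* K) hΦ hαH]; exact hcoc
  rw [negOnePow_log_detZero_eq_one_iff σ hvσ hϖ hσϖ hunit hSt hΦ ⟨γ, hγU⟩ hγH hell α hcomm hcoc']
  refine exists_congr fun z => exists_congr fun h => and_congr_right fun _ => ?_
  refine ⟨fun ⟨hh, heq⟩ => ⟨hh, ?_⟩, fun ⟨hh, heq⟩ => ⟨hh, ?_⟩⟩
  · rw [← unitaryTwist_eq_qsInvolution_of_mem_HTildePoints (σ : K →+* K) hΦ hh]; exact heq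
  · rw [unitaryTwist_eq_qsInvolution_of_mem_HTildePoints (σ : K →+* K) hΦ hh]; exact heq

end Valued

end Summit.HodgeConjecture.HodgeConjecture.R90.S6

end
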